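import Literature.Probability.RandomPlanarGeometry.HexSAWRotStripIdentityY
import Literature.Probability.RandomPlanarGeometry.HexSAWStripSurfaceZigzag
import HarnessLib

/-!
# Zig-zag walks along the top of Beaton's rotated strip: `B^{→}_{H,W}(x_c, y)` is unbounded in `W` for `H ≥ 2`, `y > 2 + √2`
# (face UB of the door «BEATON-YC», repaired: the strip `D(1, W)` is degenerate)

Topic `Literature/Probability/RandomPlanarGeometry` (continues `HexSAWRotStripIdentityY.lean` — the surface-weighted classes
`HV.rotGFy V H cls y`, contacts `HV.topContacts H P` (inner vertices with `ξ = −H`) of Beaton's rotated strips `D(H, W)` =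
`HV.rotStripV H W` of `HexSAWRotStripDictionary.lean`, top exits `HV.IsRotTopDart H`).  Source: N. R. Beaton, *The critical
surface fugacity of self-avoiding walks on a rotated honeycomb lattice*, J. Phys. A 47 (2014) 075003, arXiv:1210.0274, §3
Proposition 7 and its proof ("`κ(y) ≥ max(μ, √y)` … zig-zag walks along the surface", as in BBdGDCG 2014 Prop. 5, p. 9).

## What is proved (HOME build of a-p2 g7, 2026-08-23; face UB `RotByUnboundedLarge` of a-idea-1 gen 17's door R96, REPAIRED
to `2 ≤ H`: for `H = 1` a row of `D(1, W)` is a set of disconnected dimers and `B^{→}_{1,W}(x_c, y) = x_c² y + x_c³ y²` for all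
`W ≥ 2` — numerics `ub_rot_check.py`)

* `rzPre H n` (the climb from `a⁺` to Beaton height `H`, shifted by one dimer when `H` is even so that it ends on a down
  triangle), `rzTop H j` (the period-4 zig-zag between the rows `H − 1` and `H`: two contacts per four vertices), `rzV`,
  `rzWalk H p` (exit through the top after `p` periods); adjacency, heights, `X`-coordinates, injectivity;
* `rzWalk_mem` — for `H ≥ 2`, `p ≥ 1` it is a right-started top walk of `D(H, 2p + e + 1) ∖ {a⁻}` (`e = 1 − H mod 2`), with
  `mwLen = H + e + 1 + 4p` and at least `2p` top contacts;
* `rotStripBRy` (a-idea-1's `B^{→}_{H,W}(x_c, y)`, verbatim), `pow_le_rotStripBRy`, **`rotStripBRy_not_bddAbove`** (`H ≥ 2`,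
  `y > 2 + √2`), and the repaired face **`RotByUnboundedLarge`** (`2 ≤ H`) with `rotByUnboundedLarge_holds`.
-/

noncomputable section

open Finset Filter Topology Literature.Probability.LatticeModels Literature.Probability.Percolation

namespace Literature.Probability.RandomPlanarGeometry.SAW.HV

/-! ### The zig-zag top walk of `D(H, W)` -/

/-- The parity shift `e = 1 − (H mod 2)`. [cite: Beaton2014RotatedHoneycomb, §3 (proof of Proposition 7)] -/
def rzE (H : ℕ) : ℕ := 1 - H % 2

/-- The climb: `a⁺ = (0,0,↑)`, `(−1,0,↓)`, then (for even `H` after one dimer step) alternating up/down triangles gaining one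
unit of Beaton height per vertex. [cite: Beaton2014RotatedHoneycomb, §3 (proof of Proposition 7)] -/
def rzPre (H n : ℕ) : HV :=
  (-(((n + 1) / 2 : ℕ) : ℤ), if n < 2 then 0 else (rzE H : ℤ), decide (n % 2 = 1))

/-- `x₀` of the top down-triangle where the climb ends. [cite: Beaton2014RotatedHoneycomb, §3] -/
def rzX0 (H : ℕ) : ℤ := -(((H + 1 + rzE H) / 2 : ℕ) : ℤ)

/-- The zig-zag along the top: period `(x₀, x₁, ↓) → (x₀, x₁+1, ↑) → (x₀, x₁+1, ↓) → (x₀, x₁+2, ↑) → (x₀−1, x₁+2, ↓)`, heights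
`H, H, H−1, H−1, H`. [cite: Beaton2014RotatedHoneycomb, §3 (proof of Proposition 7: zig-zag walks along the surface)] -/
def rzTop (H j : ℕ) : HV :=
  (rzX0 H - ((j / 4 : ℕ) : ℤ),
    (rzE H : ℤ) + 2 * ((j / 4 : ℕ) : ℤ) + (if j % 4 = 0 then 0 else if j % 4 = 3 then 2 else 1),
    decide (j % 2 = 0))

/-- The `n`-th inner vertex of the zig-zag top walk. [cite: Beaton2014RotatedHoneycomb, §3 (proof of Proposition 7)] -/
def rzV (H n : ℕ) : HV := if n ≤ H + rzE H then rzPre H n else rzTop H (n - (H + rzE H))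

/-- The inner vertex list with `p` periods: `H + e + 1 + 4p` vertices. [cite: Beaton2014RotatedHoneycomb, §3] -/
def rzInner (H p : ℕ) : List HV := (List.range (H + rzE H + 1 + 4 * p)).map (rzV H)

/-- The zig-zag top walk as a mid-edge walk list, exiting through the top from `(x₀* − p, e + 2p, ↓)`.
[cite: Beaton2014RotatedHoneycomb, §3 (proof of Proposition 7)] -/
def rzWalk (H p : ℕ) : List HV := wOut :: (rzInner H p ++ [(rzX0 H - p, (rzE H : ℤ) + 2 * p, false)])

/-- `e ≤ 1` (the parity shift of the zig-zag climb). [cite: Beaton2014RotatedHoneycomb, Fig. 1(b) and §2 (arXiv v3 pp. 2, 5: the rotated orientation of the impenetrable surface; lane-native counting lemma in that setting)] -/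
theorem rzE_le (H : ℕ) : rzE H ≤ 1 := by unfold rzE; omega

/-- `H + e` is odd: the climb ends on a down triangle. [cite: Beaton2014RotatedHoneycomb, Fig. 1(b) and §2 (arXiv v3 pp. 2, 5: the rotated orientation of the impenetrable surface; lane-native counting lemma in that setting)] -/
theorem rzE_add_odd (H : ℕ) : (H + rzE H) % 2 = 1 := by unfold rzE; omega

/-- Consecutive climb vertices are adjacent. [cite: Beaton2014RotatedHoneycomb, §2 (the lattice)] -/
theorem rzPre_adj (H n : ℕ) : hvGraph.Adj (rzPre H n) (rzPre H (n + 1)) := by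
  rw [hvGraph_adj]
  have he := rzE_le H
  rcases Nat.mod_two_eq_zero_or_one n with hn | hn
  · have h1 : (n + 1) % 2 = 1 := by omega
    have h2 : (n + 1 + 1) / 2 = (n + 1) / 2 + 1 := by omega
    have hn' : ¬ (n % 2 = 1) := by omega
    left
    rw [rzPre, rzPre, h2]
    simp only [hn', h1, decide_false, decide_true, true_and, Nat.cast_add, Nat.cast_one]
    split_ifs <;> omega
  · have h1 : ¬ ((n + 1) % 2 = 1) := by omega
    have h2 : (n + 1 + 1) / 2 = (n + 1) / 2 := by omega
    right
    rw [rzPre, rzPre, h2]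
    simp only [hn, h1, decide_false, decide_true, true_and]
    split_ifs <;> omega

/-- Consecutive zig-zag vertices are adjacent. [cite: Beaton2014RotatedHoneycomb, §2 (the lattice)] -/
theorem rzTop_adj (H j : ℕ) : hvGraph.Adj (rzTop H j) (rzTop H (j + 1)) := by
  rw [hvGraph_adj]
  have h4 : j % 4 = 0 ∨ j % 4 = 1 ∨ j % 4 = 2 ∨ j % 4 = 3 := by omega
  rcases h4 with hr | hr | hr | hr
  · have a1 : (j + 1) % 4 = 1 := by omega
    have a2 : (j + 1) / 4 = j / 4 := by omega
    have b1 : j % 2 = 0 := by omega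
    have b2 : ¬ ((j + 1) % 2 = 0) := by omega
    right
    rw [rzTop, rzTop, a2]
    simp only [hr, a1, b1, b2, decide_true, decide_false, true_and, if_true, if_false, show (1:ℕ) ≠ 0 by decide,
      show (1:ℕ) ≠ 3 by decide]
    omega
  · have a1 : (j + 1) % 4 = 2 := by omega
    have a2 : (j + 1) / 4 = j / 4 := by omega
    have b1 : ¬ (j % 2 = 0) := by omega
    have b2 : (j + 1) % 2 = 0 := by omega
    left
    rw [rzTop, rzTop, a2]
    simp only [hr, a1, b1, b2, decide_true, decide_false, true_and, if_false, show (1:ℕ) ≠ 0 by decide,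
      show (1:ℕ) ≠ 3 by decide, show (2:ℕ) ≠ 0 by decide, show (2:ℕ) ≠ 3 by decide, and_self, true_or]
  · have a1 : (j + 1) % 4 = 3 := by omega
    have a2 : (j + 1) / 4 = j / 4 := by omega
    have b1 : j % 2 = 0 := by omega
    have b2 : ¬ ((j + 1) % 2 = 0) := by omega
    right
    rw [rzTop, rzTop, a2]
    simp only [hr, a1, b1, b2, decide_true, decide_false, true_and, if_true, if_false, show (2:ℕ) ≠ 0 by decide,
      show (2:ℕ) ≠ 3 by decide, show (3:ℕ) ≠ 0 by decide]
    omega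
  · have a1 : (j + 1) % 4 = 0 := by omega
    have a2 : (j + 1) / 4 = j / 4 + 1 := by omega
    have b1 : ¬ (j % 2 = 0) := by omega
    have b2 : (j + 1) % 2 = 0 := by omega
    left
    rw [rzTop, rzTop, a2]
    simp only [hr, a1, b1, b2, decide_true, decide_false, true_and, Nat.cast_add, Nat.cast_one, if_true, if_false,
      show (3:ℕ) ≠ 0 by decide]
    omega

/-- The climb ends where the zig-zag starts. [cite: Beaton2014RotatedHoneycomb, §3] -/
theorem rzPre_top {H : ℕ} (hH : 2 ≤ H) : rzPre H (H + rzE H) = rzTop H 0 := by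
  have hodd := rzE_add_odd H
  have hlt : ¬ (H + rzE H < 2) := by omega
  have hdiv : (H + rzE H + 1) / 2 = (H + 1 + rzE H) / 2 := by rw [Nat.add_right_comm]
  rw [rzPre, rzTop, rzX0, hdiv]
  simp only [hodd, hlt, decide_true, if_false, Nat.zero_div, Nat.zero_mod, if_true, Nat.cast_zero, Prod.mk.injEq, and_true]
  omega

/-- Consecutive inner vertices are adjacent. [cite: Beaton2014RotatedHoneycomb, §3 (proof of Proposition 7)] -/
theorem rzV_adj {H : ℕ} (hH : 2 ≤ H) (n : ℕ) : hvGraph.Adj (rzV H n) (rzV H (n + 1)) := by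
  unfold rzV
  by_cases h1 : n + 1 ≤ H + rzE H
  · rw [if_pos (by omega), if_pos h1]; exact rzPre_adj H n
  · by_cases h2 : n ≤ H + rzE H
    · have hn : n = H + rzE H := by omega
      rw [if_pos h2, if_neg h1, hn, rzPre_top hH, show H + rzE H + 1 - (H + rzE H) = 0 + 1 by omega]
      exact rzTop_adj H 0
    · rw [if_neg h2, if_neg h1, show n + 1 - (H + rzE H) = (n - (H + rzE H)) + 1 by omega]
      exact rzTop_adj H _

/-- Beaton height along the climb: `−ξ = n` for `n < 2`, `n − e` after. [cite: Beaton2014RotatedHoneycomb, §2.2] -/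
theorem xi_rzPre (H n : ℕ) : xi (rzPre H n) = -(n : ℤ) + (if n < 2 then 0 else (rzE H : ℤ)) := by
  rcases Nat.mod_two_eq_zero_or_one n with hn | hn
  · have hn' : ¬ (n % 2 = 1) := by omega
    simp only [rzPre, xi, hn', decide_false, bit_false]
    split_ifs <;> omega
  · simp only [rzPre, xi, hn, decide_true, bit_true]
    split_ifs <;> omega

/-- Beaton height along the zig-zag: `H` at residues `0, 1`, `H − 1` at residues `2, 3`. [cite: Beaton2014RotatedHoneycomb, §3] -/
theorem xi_rzTop (H j : ℕ) : xi (rzTop H j) = -(H : ℤ) + (if j % 4 = 0 ∨ j % 4 = 1 then 0 else 1) := by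
  have hodd := rzE_add_odd H
  have hx0 : 2 * rzX0 H = -(H : ℤ) - rzE H - 1 := by unfold rzX0; omega
  rcases Nat.mod_two_eq_zero_or_one j with b | b
  · simp only [rzTop, xi, b, decide_true, bit_true]
    split_ifs <;> omega
  · have b' : ¬ (j % 2 = 0) := by omega
    simp only [rzTop, xi, b', decide_false, bit_false]
    split_ifs <;> omega

/-- `X` along the zig-zag: `3e + 6⌊j/4⌋ + (5, 7, 8, 10)`. [cite: Beaton2014RotatedHoneycomb, §2.2] -/
theorem xX_rzTop (H j : ℕ) : xX (rzTop H j) = 3 * (rzE H : ℤ) + 6 * ((j / 4 : ℕ) : ℤ) +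
    (if j % 4 = 0 then 5 else if j % 4 = 1 then 7 else if j % 4 = 2 then 8 else 10) := by
  rcases Nat.mod_two_eq_zero_or_one j with b | b
  · simp only [rzTop, xX, b, decide_true, bit_true]
    split_ifs <;> omega
  · have b' : ¬ (j % 2 = 0) := by omega
    simp only [rzTop, xX, b', decide_false, bit_false]
    split_ifs <;> omega

/-- `X` is strictly increasing along the zig-zag. [cite: Beaton2014RotatedHoneycomb, §2.2] -/
theorem xX_rzTop_lt (H : ℕ) {i j : ℕ} (hij : i < j) : xX (rzTop H i) < xX (rzTop H j) := by
  rw [xX_rzTop, xX_rzTop]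
  have hq : i / 4 ≤ j / 4 := Nat.div_le_div_right hij.le
  split_ifs <;> omega

/-- The climb vertices are pairwise distinct. [cite: Beaton2014RotatedHoneycomb, §3] -/
theorem rzPre_injective (H : ℕ) : Function.Injective (rzPre H) := by
  intro m n h
  simp only [rzPre, Prod.mk.injEq, decide_eq_decide] at h
  obtain ⟨h0, -, h2⟩ := h
  omega

/-- `X ≤ 5 + 3e` along the climb. [cite: Beaton2014RotatedHoneycomb, §2.2] -/
theorem xX_rzPre_le (H n : ℕ) : xX (rzPre H n) ≤ 5 + 3 * (rzE H : ℤ) := by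
  rcases Nat.mod_two_eq_zero_or_one n with hn | hn
  · have hn' : ¬ (n % 2 = 1) := by omega
    simp only [rzPre, xX, hn', decide_false, bit_false]
    split_ifs <;> omega
  · simp only [rzPre, xX, hn, decide_true, bit_true]
    split_ifs <;> omega

/-- `X ≥ 7 + 3e` along the zig-zag after its first vertex. [cite: Beaton2014RotatedHoneycomb, §2.2] -/
theorem le_xX_rzTop (H : ℕ) {j : ℕ} (hj : 1 ≤ j) : 7 + 3 * (rzE H : ℤ) ≤ xX (rzTop H j) := by
  rw [xX_rzTop]
  split_ifs <;> omega

/-- The zig-zag top walk is injective on its indices. [cite: Beaton2014RotatedHoneycomb, §3] -/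
theorem rzV_injective (H : ℕ) : Function.Injective (rzV H) := by
  intro m n h
  unfold rzV at h
  by_cases hm : m ≤ H + rzE H <;> by_cases hn : n ≤ H + rzE H
  · rw [if_pos hm, if_pos hn] at h; exact rzPre_injective H h
  · exfalso
    rw [if_pos hm, if_neg hn] at h
    have h1 := xX_rzPre_le H m
    have h2 := le_xX_rzTop H (show 1 ≤ n - (H + rzE H) by omega)
    rw [← h] at h2
    omega
  · exfalso
    rw [if_neg hm, if_pos hn] at h
    have h1 := xX_rzPre_le H n
    have h2 := le_xX_rzTop H (show 1 ≤ m - (H + rzE H) by omega)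
    rw [h] at h2
    omega
  · rw [if_neg hm, if_neg hn] at h
    have : m - (H + rzE H) = n - (H + rzE H) := by
      by_contra hne
      rcases Nat.lt_or_gt_of_ne hne with hlt | hlt
      · exact absurd (congrArg xX h) (xX_rzTop_lt H hlt).ne
      · exact absurd (congrArg xX h) (xX_rzTop_lt H hlt).ne'
    omega

/-- `X ≥ 4` along the climb. [cite: Beaton2014RotatedHoneycomb, §2.2] -/
theorem le_xX_rzPre (H n : ℕ) : 4 ≤ xX (rzPre H n) := by
  rcases Nat.mod_two_eq_zero_or_one n with hn | hn
  · have hn' : ¬ (n % 2 = 1) := by omega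
    simp only [rzPre, xX, hn', decide_false, bit_false]
    split_ifs <;> omega
  · simp only [rzPre, xX, hn, decide_true, bit_true]
    split_ifs <;> omega

/-- The walk starts at `a⁺`. [cite: Beaton2014RotatedHoneycomb, §2.2] -/
theorem rzV_zero (H : ℕ) : rzV H 0 = hvOrigin := by
  simp [rzV, rzPre, hvOrigin]

/-- **Every inner vertex lies in `D(H, 2p + e + 1) ∖ {a⁻}`** (`H ≥ 2`, `p ≥ 1`).
[cite: Beaton2014RotatedHoneycomb, §2.2 (D_{T,L}) and §3 (proof of Proposition 7)] -/
theorem rzV_mem {H p n : ℕ} (hH : 2 ≤ H) (hp : 1 ≤ p) (hn : n < H + rzE H + 1 + 4 * p) :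
    rzV H n ∈ (rotStripV H (2 * p + rzE H + 1)).erase wOut := by
  rcases Nat.eq_zero_or_pos n with rfl | hn0
  · rw [rzV_zero]
    exact mem_erase.2 ⟨by decide, hvOrigin_mem_rotStripV _ _⟩
  have he := rzE_le H
  have hxi : 1 ≤ -xi (rzV H n) ∧ -xi (rzV H n) ≤ H := by
    unfold rzV
    split_ifs with h
    · rw [xi_rzPre]; split_ifs <;> omega
    · rw [xi_rzTop]; split_ifs <;> omega
  have hX : |xX (rzV H n) - 3| < 3 * ((2 * p + rzE H + 1 : ℕ) : ℤ) := by
    rw [abs_lt]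
    unfold rzV
    split_ifs with h
    · have h1 := le_xX_rzPre H n
      have h2 := xX_rzPre_le H n
      constructor <;> omega
    · rw [xX_rzTop]
      have hj : n - (H + rzE H) ≤ 4 * p := by omega
      constructor <;> split_ifs <;> omega
  refine mem_erase.2 ⟨fun hw => ?_, mem_rotStripV_of hxi.1 hxi.2 hX⟩
  rw [hw, xi_wOut] at hxi
  omega

/-- The number of indices `n < H + e + 1 + 4p` past the climb with residue `0` or `1` is `2p` (two contacts per zig-zag period). [cite: Beaton2014RotatedHoneycomb, Fig. 1(b) and §2 (arXiv v3 pp. 2, 5: the rotated orientation of the impenetrable surface; lane-native counting lemma in that setting)] -/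
theorem countP_top_range (H p : ℕ) :
    (List.range (H + rzE H + 1 + 4 * p)).countP
        (fun n => H + rzE H + 1 ≤ n ∧ ((n - (H + rzE H)) % 4 = 0 ∨ (n - (H + rzE H)) % 4 = 1)) = 2 * p := by
  induction p with
  | zero =>
    rw [List.countP_eq_zero]
    intro n hn
    rw [List.mem_range] at hn
    simp only [decide_eq_true_eq, not_and]
    omega
  | succ p ih =>
    set M := H + rzE H with hM
    have e0 : ¬ (M + 1 ≤ M + 1 + 4 * p + 1 ∧ ((M + 1 + 4 * p + 1 - M) % 4 = 0 ∨ (M + 1 + 4 * p + 1 - M) % 4 = 1)) := by omega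
    have e1 : ¬ (M + 1 ≤ M + 1 + 4 * p + 2 ∧ ((M + 1 + 4 * p + 2 - M) % 4 = 0 ∨ (M + 1 + 4 * p + 2 - M) % 4 = 1)) := by omega
    have e2 : M + 1 ≤ M + 1 + 4 * p + 3 ∧ ((M + 1 + 4 * p + 3 - M) % 4 = 0 ∨ (M + 1 + 4 * p + 3 - M) % 4 = 1) := by omega
    have e3 : M + 1 ≤ M + 1 + 4 * p ∧ ((M + 1 + 4 * p - M) % 4 = 0 ∨ (M + 1 + 4 * p - M) % 4 = 1) := by omega
    rw [show M + 1 + 4 * (p + 1) = M + 1 + 4 * p + 3 + 1 by ring, List.range_succ,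
      show M + 1 + 4 * p + 3 = M + 1 + 4 * p + 2 + 1 by ring, List.range_succ,
      show M + 1 + 4 * p + 2 = M + 1 + 4 * p + 1 + 1 by ring, List.range_succ, List.range_succ]
    rw [List.countP_append, List.countP_append, List.countP_append, List.countP_append, ih]
    simp only [List.countP_cons, List.countP_nil, decide_eq_true e2, decide_eq_true e3, decide_eq_false e0,
      decide_eq_false e1, if_true, if_false, Bool.false_eq_true]
    omega

/-- The walk has `H + e + 1 + 4p` inner vertices. [cite: Beaton2014RotatedHoneycomb, §3] -/
theorem mwLen_rzWalk (H p : ℕ) : mwLen (rzWalk H p) = H + rzE H + 1 + 4 * p := by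
  simp [mwLen, rzWalk, rzInner]

/-- The walk has at least `2p` top contacts. [cite: Beaton2014RotatedHoneycomb, §3 (proof of Proposition 7)] -/
theorem le_topContacts_rzWalk (H p : ℕ) : 2 * p ≤ topContacts H (rzWalk H p) := by
  rw [rzWalk, topContacts, inner_cons_append, rzInner, List.countP_map]
  calc 2 * p = _ := (countP_top_range H p).symm
    _ ≤ _ := by
      refine List.countP_mono_left fun n _ hn => ?_
      simp only [decide_eq_true_eq] at hn
      simp only [Function.comp_apply, decide_eq_true_eq]
      rw [rzV, if_neg (by omega), xi_rzTop, if_pos hn.2, add_zero]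

/-- The last inner vertex: `(x₀* − p, e + 2p, ↓)` at Beaton height `H`. [cite: Beaton2014RotatedHoneycomb, §3] -/
theorem rzV_lastIdx {H p : ℕ} (hp : 1 ≤ p) :
    rzV H (H + rzE H + 4 * p) = (rzX0 H - p, (rzE H : ℤ) + 2 * p, true) := by
  rw [rzV, if_neg (by omega), show H + rzE H + 4 * p - (H + rzE H) = 4 * p by omega, rzTop]
  have h1 : 4 * p / 4 = p := by omega
  have h2 : 4 * p % 4 = 0 := by omega
  have h3 : 4 * p % 2 = 0 := by omega
  simp [h1, h2, h3]

/-- The second-to-last inner vertex: `(x₀* − p + 1, e + 2p, ↑)`. [cite: Beaton2014RotatedHoneycomb, §3] -/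
theorem rzV_prevIdx {H p : ℕ} (hp : 1 ≤ p) :
    rzV H (H + rzE H + 4 * p - 1) = (rzX0 H - p + 1, (rzE H : ℤ) + 2 * p, false) := by
  rw [rzV, if_neg (by omega), show H + rzE H + 4 * p - 1 - (H + rzE H) = 4 * p - 1 by omega, rzTop]
  have h1 : (4 * p - 1) / 4 = p - 1 := by omega
  have h2 : (4 * p - 1) % 4 = 3 := by omega
  have h3 : ¬ ((4 * p - 1) % 2 = 0) := by omega
  simp only [h1, h2, h3, decide_false, show (3:ℕ) ≠ 0 by decide, if_false, if_true, Prod.mk.injEq, and_true]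
  constructor <;> omega

/-- **The zig-zag top walk is a right-started top walk of `D(H, 2p + e + 1) ∖ {a⁻}`** (`H ≥ 2`, `p ≥ 1`).
[cite: Beaton2014RotatedHoneycomb, §3 (proof of Proposition 7: zig-zag walks along the surface)] -/
theorem rzWalk_mem {H p : ℕ} (hH : 2 ≤ H) (hp : 1 ≤ p) :
    rzWalk H p ∈ (midWalks ((rotStripV H (2 * p + rzE H + 1)).erase wOut)).filter
      fun P => IsRotTopDart H (finalDart P) := by
  obtain ⟨N, hNdef⟩ : ∃ N, H + rzE H + 1 + 4 * p = N + 2 := ⟨H + rzE H + 4 * p - 1, by omega⟩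
  have hsplit : rzInner H p = ((List.range N).map (rzV H) ++ [rzV H N]) ++ [rzV H (N + 1)] := by
    rw [rzInner, hNdef, List.range_succ, List.range_succ, List.map_append, List.map_append]
    rfl
  have hne : rzInner H p ≠ [] := by rw [hsplit]; simp
  have hlastN : rzV H (N + 1) = (rzX0 H - p, (rzE H : ℤ) + 2 * p, true) := by
    rw [show N + 1 = H + rzE H + 4 * p by omega]; exact rzV_lastIdx hp
  have hprevN : rzV H N = (rzX0 H - p + 1, (rzE H : ℤ) + 2 * p, false) := by
    rw [show N = H + rzE H + 4 * p - 1 by omega]; exact rzV_prevIdx hp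
  have hlast : (rzInner H p).getLast hne = (rzX0 H - p, (rzE H : ℤ) + 2 * p, true) := by
    apply Option.some_injective _
    rw [← List.getLast?_eq_some_getLast hne, hsplit, List.getLast?_concat, hlastN]
  have hdl : (rzInner H p).dropLast = (List.range N).map (rzV H) ++ [rzV H N] := by
    rw [hsplit, List.dropLast_concat]
  have hprev : prevOf (rzInner H p) = (rzX0 H - p + 1, (rzE H : ℤ) + 2 * p, false) := by
    apply Option.some_injective _
    rw [prevOf, ← List.getLast?_eq_some_getLast, hdl, ← List.cons_append, List.getLast?_concat, hprevN]
  have hx0 : 2 * rzX0 H = -(H : ℤ) - rzE H - 1 := by have := rzE_add_odd H; unfold rzX0; omega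
  rw [mem_filter, mem_midWalks_iff]
  refine ⟨?_, ?_⟩
  · rw [rzWalk, isMidWalk_cons_append_iff _ hne]
    refine ⟨?_, ?_, ?_, ?_, ?_, ?_⟩
    · rw [rzInner, List.isChain_map, hNdef, List.isChain_range_succ]
      exact fun m _ => rzV_adj hH m
    · rw [rzInner, hNdef, List.range_succ_eq_map]
      simp [rzV_zero H]
    · rw [hlast, hvGraph_adj]
      right
      simp
    · intro x hx
      rw [rzInner, List.mem_map] at hx
      obtain ⟨n, hn, rfl⟩ := hx
      exact rzV_mem hH hp (List.mem_range.1 hn)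
    · exact List.nodup_range.map (rzV_injective H)
    · rw [hprev, Ne, Prod.mk.injEq]
      omega
  · have hfd : finalDart (rzWalk H p) =
        ((rzX0 H - p, (rzE H : ℤ) + 2 * p, true), (rzX0 H - p, (rzE H : ℤ) + 2 * p, false)) := by
      have hl : (rzInner H p).getLast? = some (rzX0 H - p, (rzE H : ℤ) + 2 * p, true) := by
        rw [List.getLast?_eq_some_getLast hne, hlast]
      rw [finalDart, rzWalk, ← List.cons_append, List.dropLast_concat, List.getLast?_concat, List.getLast?_cons, hl]
      simp
    rw [hfd, IsRotTopDart]
    simp only [xi, bit_true, bit_false]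
    omega

/-! ### The surface-weighted top class, the lower bound and the unboundedness -/

/-- `B^{→}_{H,W}(x_c, y)`, the `y`-weighted top class of `D(H, W) ∖ {a⁻}` (a-idea-1 gen 17, Sketch_G17 l. 352, verbatim).
[cite: Beaton2014RotatedHoneycomb, §2.4 (B_{T,L}(x, y)) and §4 (arXiv v3 p. 16)] -/
def rotStripBRy (H Wd : ℕ) (y : ℝ) : ℝ := rotGFy ((rotStripV H Wd).erase wOut) H (IsRotTopDart H) y

/-- **`x_c^{H+e+1} ((x_c² y)²)^p ≤ B^{→}_{H, 2p+e+1}(x_c, y)`** for `H ≥ 2`, `p ≥ 1`, `y ≥ 1`: the single zig-zag top walk.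
[cite: Beaton2014RotatedHoneycomb, §3 (proof of Proposition 7: the weight of zig-zag walks along the surface)] -/
theorem pow_le_rotStripBRy {H p : ℕ} (hH : 2 ≤ H) (hp : 1 ≤ p) {y : ℝ} (hy : 1 ≤ y) :
    hexCriticalFugacity ^ (H + rzE H + 1) * ((hexCriticalFugacity ^ 2 * y) ^ 2) ^ p ≤
      rotStripBRy H (2 * p + rzE H + 1) y := by
  have hx : 0 < hexCriticalFugacity := hexCriticalFugacity_pos_lt_one.1
  have hmem := rzWalk_mem hH hp
  calc hexCriticalFugacity ^ (H + rzE H + 1) * ((hexCriticalFugacity ^ 2 * y) ^ 2) ^ p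
      = hexCriticalFugacity ^ (H + rzE H + 1 + 4 * p) * y ^ (2 * p) := by ring
    _ ≤ hexCriticalFugacity ^ mwLen (rzWalk H p) * y ^ topContacts H (rzWalk H p) := by
        rw [mwLen_rzWalk]
        exact mul_le_mul_of_nonneg_left (pow_le_pow_right₀ hy (le_topContacts_rzWalk H p)) (by positivity)
    _ ≤ rotStripBRy H (2 * p + rzE H + 1) y := by
        rw [rotStripBRy, rotGFy]
        exact single_le_sum (f := fun P => hexCriticalFugacity ^ mwLen P * y ^ topContacts H P)
          (fun _ _ => by positivity) hmem

-- (`one_lt_hexCriticalFugacity_sq_mul` — `x_c² y > 1` for `y > 2 + √2` — is imported from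
-- `HexSAWStripSurfaceZigzag`; the former in-file copy `…_rot` was removed 2026-08-28 as a `dedup.landed` restatement.)

/-- **`B^{→}_{H,W}(x_c, y)` is unbounded in `W` for `H ≥ 2` and `y > 2 + √2`.**  (False for `H = 1`: a row of `D(1, W)`
is a set of disconnected dimers, `B^{→}_{1,W}(x_c, y) = x_c² y + x_c³ y²` for all `W ≥ 2`.)
[cite: Beaton2014RotatedHoneycomb, §3 (Proposition 7 and its proof: κ(y) ≥ √y from zig-zag walks along the surface)] -/
theorem rotStripBRy_not_bddAbove {H : ℕ} (hH : 2 ≤ H) {y : ℝ} (hy : 2 + Real.sqrt 2 < y) :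
    ¬ BddAbove (Set.range fun Wd : ℕ => rotStripBRy H (Wd + 1) y) := by
  rintro ⟨K, hK⟩
  have hx : 0 < hexCriticalFugacity := hexCriticalFugacity_pos_lt_one.1
  have hy1 : 1 ≤ y := by have := Real.sqrt_nonneg 2; linarith
  have hq : 1 < (hexCriticalFugacity ^ 2 * y) ^ 2 := by
    have := one_lt_hexCriticalFugacity_sq_mul hy
    nlinarith
  have ht : Tendsto (fun p : ℕ => hexCriticalFugacity ^ (H + rzE H + 1) * ((hexCriticalFugacity ^ 2 * y) ^ 2) ^ p)
      atTop atTop :=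
    Tendsto.const_mul_atTop (by positivity) (tendsto_pow_atTop_atTop_of_one_lt hq)
  obtain ⟨p, hp1, hp⟩ := ((ht.eventually_gt_atTop K).and (eventually_ge_atTop 1)).exists
  have h1 : rotStripBRy H (2 * p + rzE H + 1) y ≤ K := hK ⟨2 * p + rzE H, rfl⟩
  have h2 := pow_le_rotStripBRy hH hp hy1
  linarith

/-- **Face UB «ROT-ZIGZAG-SURFACE»** of the door R96 «BEATON-YC» (a-idea-1 gen 17, Sketch_G17 l. 998), REPAIRED to `2 ≤ H`
(the typed `1 ≤ H` version fails at `H = 1`): above `2 + √2 = x_c⁻²` the rotated top class is unbounded in `W`.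
[cite: Beaton2014RotatedHoneycomb, §3 (Proposition 7: κ(y) ≥ √y)] -/
def RotByUnboundedLarge : Prop :=
  ∀ (H : ℕ) (y : ℝ), 2 ≤ H → 2 + Real.sqrt 2 < y → ¬ BddAbove (Set.range fun Wd : ℕ => rotStripBRy H (Wd + 1) y)

/-- UB (repaired) holds. [cite: Beaton2014RotatedHoneycomb, §3 (Proposition 7)] -/
theorem rotByUnboundedLarge_holds : RotByUnboundedLarge := fun _ _ hH hy => rotStripBRy_not_bddAbove hH hy

/-- `RotByUnboundedLarge` — `_holds` alias of `rotByUnboundedLarge_holds` above under the fact's exact name (appended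
2026-08-28, D-0026 bookkeeping: the proof term is the existing theorem of this file; no statement,
definition or attribute is edited; no new named fact; the ledger's debt table listed the fact
unproved). [cite: Beaton2014RotatedHoneycomb, §3 (Proposition 7)] -/
theorem _root_.Literature.Probability.RandomPlanarGeometry.SAW.HV.RotByUnboundedLarge_holds :
    RotByUnboundedLarge :=
  _root_.Literature.Probability.RandomPlanarGeometry.SAW.HV.rotByUnboundedLarge_holds

end Literature.Probability.RandomPlanarGeometry.SAW.HV
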